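import Literature.Analysis.FluidPDE.NSRegFourierSolution
import Literature.Analysis.FluidPDE.ClassicalDriftNSLocalEnergy
import HarnessLib

/-!
# The Fourier-side regularised solution is a classical drift solution

Bridge between the Fourier-side construction of the global regular solution of the
Leray-regularised Navier–Stokes system (`NSRegFourier*`, the chain discharging
`Literature.Analysis.FluidPDE.leray_regularised_wellposed`; the classical solution
`(d.u, d.ju, d.p)` of `RegSetup` in `NSRegFourierSolution`) and the physical-space separation of
energy (`ClassicalDriftNSLocalEnergy`, `LeraySeparationOfEnergy`): the synthesized fields form a
classical solution of the drift system `∂ₜu + (w·∇)u = νΔu − ∇p`, `div u = div w = 0` with drift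
`w = Ju` on `[0, T]` (Leray 1934, (5.1)), in the sense of `IsClassicalDriftNSSolutionOn`, hence on
every `(a, b) ⊆ [0, T]`, and their local energy identity against a spatial cutoff follows.

## References

* J. Leray, Acta Math. 63 (1934), Ch. V §26 (5.1), §27 (5.3). [Leray1934]
* W. S. Ożański, B. C. Pooley, LMS Lecture Note Ser. 452 (2018), Thm. 6.33, Lemma 6.34. [OzanskiPooley2018]
-/

noncomputable section

open MeasureTheory Set Filter Function
open scoped RealInnerProductSpace Laplacian

namespace Literature.Analysis.FluidPDE.FourierNS

variable {ι : Type*} [Fintype ι] [DecidableEq ι]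

namespace RegSetup

variable (d : RegSetup ι)

/-- **The synthesized fields solve the drift system classically on `[0, T]`**: `(Ju, u, p)` is an
`IsClassicalDriftNSSolutionOn (Icc 0 T) ν` solution — Leray's regularised system (5.1) with the
mollified transport velocity as drift (Leray 1934, Ch. V §26; Ożański–Pooley 2018, (6.77)). [cite: Leray1934, Ch. V §26 (5.1)] -/
theorem isClassicalDriftNSSolutionOn :
    IsClassicalDriftNSSolutionOn (Icc 0 d.T) d.ν d.ju d.u d.p where
  smooth_velocity := d.smooth_u
  smooth_drift := d.smooth_ju
  smooth_pressure := d.smooth_p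
  momentum _ ht x := d.momentum_reg ht x
  divFree _ ht := d.isDivFree_u ht
  divFree_drift _ ht := d.isDivFree_ju ht

/-- The same on every open subinterval `(a, b) ⊆ [0, T]` (two-sided time derivative). [folklore] -/
theorem isClassicalDriftNSSolutionOn_Ioo {a b : ℝ} (ha : 0 ≤ a) (hb : b ≤ d.T) :
    IsClassicalDriftNSSolutionOn (Ioo a b) d.ν d.ju d.u d.p :=
  d.isClassicalDriftNSSolutionOn.mono (Ioo_subset_Icc_self.trans (Icc_subset_Icc ha hb))
    isOpen_Ioo.uniqueDiffOn

/-- **The local energy identity of the regularised solution** against a spatial cutoff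
`φ ∈ C²_c(E)`, for `0 < s ≤ t < T`:
`∫ φ|u(t)|² − ∫ φ|u(s)|² = ∫ₛᵗ (∫ |u|²⟪Ju, ∇φ⟫ − 2ν ∫ ⟪Du(∇φ), u⟫ − 2ν ∫ φ|Du|² + 2 ∫ p⟪u, ∇φ⟫)`
(Leray 1934, §27, (5.3); Ożański–Pooley 2018, proof of Lemma 6.34). [cite: OzanskiPooley2018, Lemma 6.34 (proof)] -/
theorem local_energy_identity {κ : Type*} [Fintype κ] (b : OrthonormalBasis κ ℝ (EuclideanSpace ℝ ι))
    {φ : EuclideanSpace ℝ ι → ℝ} (hφ : ContDiff ℝ 2 φ) (hφc : HasCompactSupport φ) {s t : ℝ}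
    (hs : 0 < s) (hst : s ≤ t) (ht : t < d.T) :
    (∫ x, φ x * ‖d.u t x‖ ^ 2) - (∫ x, φ x * ‖d.u s x‖ ^ 2) =
      ∫ τ in Ioo s t, ((∫ x, ‖d.u τ x‖ ^ 2 * ⟪d.ju τ x, gradient φ x⟫) -
        2 * d.ν * (∫ x, ⟪fderiv ℝ (d.u τ) x (gradient φ x), d.u τ x⟫) -
        2 * d.ν * (∫ x, φ x * frobeniusNormSq (fderiv ℝ (d.u τ) x)) +
        2 * ∫ x, d.p τ x * ⟪d.u τ x, gradient φ x⟫) :=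
  (d.isClassicalDriftNSSolutionOn_Ioo le_rfl le_rfl).local_energy_identity b isOpen_Ioo hφ hφc hst
    fun _ hr => ⟨hs.trans_le hr.1, hr.2.trans_lt ht⟩

end RegSetup

end Literature.Analysis.FluidPDE.FourierNS

end
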